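import Literature.AnabelianGeometry.SemiGraphs.TemperedExtensionBasis

/-!
# Extensions of tempered groups, II: the extension of a tempered group by a tempered group is tempered
# ([SemiAnbd] §3 Def 3.1 (i), §5 Prop 5.2 (iii)/(iv))

Mochizuki, *Semi-graphs of anabelioids*, Publ. RIMS **42** (2006) 221–322, Def 3.1 (i) p. 33 and
Prop 5.2 (iii)/(iv) p. 64: `Π^temp_𝔊 := π₁^temp(B^temp(𝔊))` is TEMPERED ("`B^temp(𝔊)` is a connected
temperoid") and sits in "natural exact sequences `1 → Π^temp_𝔾 → Π^temp_𝔊 → Π_A → 1`"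
[cite: MochizukiSemiAnbd2006, Prop 5.2 (iv), p. 64].

PROOF-ONLY sequel of `TemperedExtensionBasis.lean` (row T54-B-top of the producer debt T54-B,
`HOME/plan/GAP-LEDGER.md` G-w4d053-1; seat abc-iut-L3-d2):

* **`isTempered_of_subgroupBasis`** — for an abstract extension `1 → Π → E → Π_A → 1` of TEMPERED
  groups and a group topology on `E` with a basis `𝓜` of neighbourhoods of `1` by subgroups whose
  traces on `Π` and images in `Π_A` are open and cofinal and whose normal members are cofinal, `E` is
  tempered in the sense of Def 3.1 (i) (`IsTempered`, `TemperedGroups.lean`): the countable-index basis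
  and separation are read off the two ends; COMPLETENESS is glued — project a compatible family of
  cosets to `Π_A` along the `aug⁻¹W`, take its limit `a = aug e₀` there, observe that the corrected
  family `e₀⁻¹ x_N` lies in the image of `Π ⧸ ι⁻¹N` (exactness modulo `N`), and take the limit of the
  preimages in `Π`;
* **`exists_isTempered_topology_of_subgroupBasis`** — the packaged form the producer
  (`exists_arithTemperedGroup`) consumes: from the bare exact sequence and `𝓜` one gets a topology on
  `E` that is a tempered group topology with `𝓜` open, `ι` a closed embedding, `aug` continuous open.

Nothing here refers to the IUT corpus; no side is taken on any disputed claim.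
-/

namespace Literature.AnabelianGeometry.SemiGraphs

namespace TemperedExtension

open Topology Filter

universe u v w

section Tempered

variable {P : Type u} [Group P] [TopologicalSpace P] [IsTopologicalGroup P]
  {A : Type v} [Group A] [TopologicalSpace A] [IsTopologicalGroup A]
  {E : Type w} [Group E] [TopologicalSpace E] [IsTopologicalGroup E]
  (ι : P →* E) (aug : E →* A) {𝓜 : Set (Subgroup E)}
  (hb : (𝓝 (1 : E)).HasBasis (fun M : Subgroup E => M ∈ 𝓜) (fun M => (M : Set E)))

include hb

/-- **The extension of a tempered group by a tempered group, glued along a basis of open subgroups,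
is tempered** ([SemiAnbd] Def 3.1 (i); the tempered topology of `Π^temp_𝔊`, Prop 5.2 (iii)/(iv)).
Hypotheses: `Π`, `Π_A` tempered; `1 → Π → E → Π_A → 1` exact; `𝓜` a basis of neighbourhoods of `1`
of the group topology of `E` whose traces on `Π` and images in `Π_A` are open and cofinal, with
cofinal normal members.  Conclusion: `E` is tempered — countable-index basis, separation, and
COMPLETENESS glued from the completeness of `Π_A` and of `Π`.
[cite: MochizukiSemiAnbd2006, Prop 5.2 (iv), p. 64] -/
theorem isTempered_of_subgroupBasis (hP : IsTempered P) (hA : IsTempered A)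
    (hex : ι.range = aug.ker) (hsurj : Function.Surjective aug)
    (hT1 : ∀ M ∈ 𝓜, IsOpen ((M.comap ι : Subgroup P) : Set P))
    (hT1' : ∀ M ∈ 𝓜, IsOpen ((M.map aug : Subgroup A) : Set A))
    (hT3 : ∀ U ∈ 𝓝 (1 : P), ∃ M ∈ 𝓜, ((M.comap ι : Subgroup P) : Set P) ⊆ U)
    (hT5 : ∀ V ∈ 𝓝 (1 : A), ∃ M ∈ 𝓜, ((M.map aug : Subgroup A) : Set A) ⊆ V)
    (hT6 : ∀ M ∈ 𝓜, ∃ N ∈ 𝓜, N ≤ M ∧ N.Normal) : IsTempered E := by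
  classical
  have hcι : Continuous ι := continuous_iota ι hb hT1
  have hcaug : Continuous aug := continuous_aug aug hb hT5
  have hoaug : IsOpenMap aug := isOpenMap_aug aug hb hT1'
  -- a normal member of `𝓜` inside every neighbourhood of `1`, as an open normal subgroup
  have hnbhd : ∀ U ∈ 𝓝 (1 : E), ∃ N : OpenNormalSubgroup E, N.toSubgroup ∈ 𝓜 ∧ (N : Set E) ⊆ U := by
    intro U hU
    obtain ⟨M, hM, hMU⟩ := hb.mem_iff.mp hU
    obtain ⟨N, hN, hNM, hNn⟩ := hT6 M hM
    exact ⟨⟨⟨N, isOpen_of_mem hb hN⟩, hNn⟩, hN, fun x hx => hMU (hNM hx)⟩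
  refine ⟨?_, ?_, ?_⟩
  · -- (a) open normal subgroups of countable index form a basis of neighbourhoods of `1`
    intro U hU
    obtain ⟨N, hN, hNU⟩ := hnbhd U hU
    refine ⟨N, ?_, hNU⟩
    exact countable_quotient ι aug hex N.toSubgroup
      (hP.countable_quotient _ (hT1 _ hN)) (hA.countable_quotient _ (hT1' _ hN))
  · -- (b) open normal subgroups separate points
    intro g hg
    by_cases haug : aug g = 1
    · obtain ⟨p, rfl⟩ := exists_eq_iota_of_aug_eq_one ι aug hex haug
      have hp : p ≠ 1 := by rintro rfl; exact hg (map_one ι)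
      obtain ⟨U, hU⟩ := hP.separated p hp
      obtain ⟨M, hM, hMU⟩ := hT3 (U : Set P) U.toOpenSubgroup.mem_nhds_one
      obtain ⟨N, hN, hNU⟩ := hnbhd (M : Set E) (hb.mem_of_mem hM)
      refine ⟨N, fun h => hU (hMU ?_)⟩
      change ι p ∈ M
      exact hNU h
    · obtain ⟨W, hW⟩ := hA.separated (aug g) haug
      obtain ⟨M, hM, hMW⟩ := hT5 (W : Set A) W.toOpenSubgroup.mem_nhds_one
      obtain ⟨N, hN, hNM⟩ := hnbhd (M : Set E) (hb.mem_of_mem hM)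
      refine ⟨N, fun h => hW (hMW ⟨g, ?_, rfl⟩)⟩
      exact hNM h
  · -- (c) completeness
    intro x hx
    -- (c1) project the family to `Π_A` along the open normal subgroups `aug⁻¹ W`
    let pre : OpenNormalSubgroup A → OpenNormalSubgroup E := fun W =>
      ⟨⟨W.toSubgroup.comap aug, W.toOpenSubgroup.isOpen.preimage hcaug⟩, inferInstance⟩
    have hpre : ∀ W : OpenNormalSubgroup A, (pre W).toSubgroup = W.toSubgroup.comap aug := fun W => rfl
    let y : (W : OpenNormalSubgroup A) → A ⧸ W.toSubgroup := fun W =>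
      QuotientGroup.map (pre W).toSubgroup W.toSubgroup aug le_rfl (x (pre W))
    have hy : ∀ (W : OpenNormalSubgroup A) (e : E), x (pre W) = (e : E ⧸ (pre W).toSubgroup) →
        y W = (aug e : A ⧸ W.toSubgroup) := by
      intro W e he
      change QuotientGroup.map _ _ aug le_rfl (x (pre W)) = _
      rw [he, QuotientGroup.map_mk]
    obtain ⟨a, ha⟩ := hA.complete y (by
      intro W W' hWW' a ha
      obtain ⟨e, he⟩ := QuotientGroup.mk_surjective (x (pre W))
      have hle : pre W ≤ pre W' := fun z hz => hWW' hz
      have he' : x (pre W') = (e : E ⧸ (pre W').toSubgroup) := hx _ _ hle e he.symm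
      rw [hy W e he.symm] at ha
      rw [hy W' e he', QuotientGroup.eq]
      exact hWW' ((QuotientGroup.eq (s := W.toSubgroup)).mp ha))
    obtain ⟨e₀, he₀⟩ := hsurj a
    -- (c2) the corrected family `e₀⁻¹ x_N` lies in the image of `Π`
    have hcorr : ∀ N : OpenNormalSubgroup E, ∃ p : P,
        ((ι p : E) : E ⧸ N.toSubgroup) = (e₀ : E ⧸ N.toSubgroup)⁻¹ * x N := by
      intro N
      obtain ⟨e, he⟩ := QuotientGroup.mk_surjective (x N)
      -- the open normal subgroup `aug N` of `Π_A`
      haveI : (N.toSubgroup.map aug).Normal := Subgroup.Normal.map inferInstance aug hsurj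
      let W : OpenNormalSubgroup A :=
        ⟨⟨N.toSubgroup.map aug, by
            change IsOpen (aug '' (N : Set E))
            exact hoaug _ N.toOpenSubgroup.isOpen⟩, inferInstance⟩
      have hNW : N ≤ pre W := fun z hz => ⟨z, hz, rfl⟩
      have hxW : x (pre W) = (e : E ⧸ (pre W).toSubgroup) := hx _ _ hNW e he.symm
      have h1 : y W = (aug e : A ⧸ W.toSubgroup) := hy W e hxW
      rw [ha W, QuotientGroup.eq] at h1
      -- `aug (e₀⁻¹ e) ∈ aug N`
      obtain ⟨p, hp⟩ := exists_coe_iota_eq ι aug hex N.toSubgroup (e₀⁻¹ * e) (by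
        have : a⁻¹ * aug e ∈ N.toSubgroup.map aug := h1
        rw [map_mul, map_inv, he₀]
        exact this)
      refine ⟨p, ?_⟩
      rw [hp, ← he, QuotientGroup.mk_mul, QuotientGroup.mk_inv]
    choose p hp using hcorr
    -- compatibility of the corrections modulo the traces
    have hpcompat : ∀ N N' : OpenNormalSubgroup E, N ≤ N' →
        (p N : P ⧸ N'.toSubgroup.comap ι) = p N' := by
      intro N N' hNN'
      rw [← coe_iota_eq_iff]
      rw [hp N']
      obtain ⟨e, he⟩ := QuotientGroup.mk_surjective (x N)
      have he' : x N' = (e : E ⧸ N'.toSubgroup) := hx _ _ hNN' e he.symm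
      have h1 : ((ι (p N) : E) : E ⧸ N.toSubgroup) = ((e₀⁻¹ * e : E) : E ⧸ N.toSubgroup) := by
        rw [hp N, ← he, QuotientGroup.mk_mul, QuotientGroup.mk_inv]
      rw [QuotientGroup.eq] at h1
      rw [he', ← QuotientGroup.mk_inv, ← QuotientGroup.mk_mul, QuotientGroup.eq]
      exact hNN' h1
    -- (c3) an open normal subgroup of `E` with trace inside a given open normal subgroup of `Π`
    have htrace : ∀ U : OpenNormalSubgroup P, ∃ N : OpenNormalSubgroup E,
        N.toSubgroup.comap ι ≤ U.toSubgroup := by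
      intro U
      obtain ⟨M, hM, hMU⟩ := hT3 (U : Set P) U.toOpenSubgroup.mem_nhds_one
      obtain ⟨N, hN, hNM⟩ := hnbhd (M : Set E) (hb.mem_of_mem hM)
      exact ⟨N, fun z hz => hMU (show ι z ∈ M from hNM hz)⟩
    choose NU hNU using htrace
    -- the family in `Π`
    let z : (U : OpenNormalSubgroup P) → P ⧸ U.toSubgroup := fun U => (p (NU U) : P ⧸ U.toSubgroup)
    have hzcompat : ∀ (U : OpenNormalSubgroup P) (N : OpenNormalSubgroup E),
        N.toSubgroup.comap ι ≤ U.toSubgroup → z U = (p N : P ⧸ U.toSubgroup) := by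
      intro U N hN
      change (p (NU U) : P ⧸ U.toSubgroup) = p N
      have h1 := hpcompat (NU U ⊓ N) (NU U) inf_le_left
      have h2 := hpcompat (NU U ⊓ N) N inf_le_right
      rw [QuotientGroup.eq] at h1 h2 ⊢
      have h1' : (p (NU U ⊓ N))⁻¹ * p (NU U) ∈ U.toSubgroup := hNU U h1
      have h2' : (p (NU U ⊓ N))⁻¹ * p N ∈ U.toSubgroup := hN h2
      have := U.toSubgroup.mul_mem (U.toSubgroup.inv_mem h1') h2'
      simpa [mul_assoc] using this
    obtain ⟨π, hπ⟩ := hP.complete z (by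
      intro U U' hUU' g hg
      have hle : (NU U).toSubgroup.comap ι ≤ U'.toSubgroup := (hNU U).trans hUU'
      rw [hzcompat U' (NU U) hle]
      change (p (NU U) : P ⧸ U.toSubgroup) = g at hg
      rw [QuotientGroup.eq] at hg ⊢
      exact hUU' hg)
    -- (c4) conclusion
    refine ⟨e₀ * ι π, fun N => ?_⟩
    have hopen : IsOpen ((N.toSubgroup.comap ι : Subgroup P) : Set P) :=
      N.toOpenSubgroup.isOpen.preimage hcι
    let U₀ : OpenNormalSubgroup P := ⟨⟨N.toSubgroup.comap ι, hopen⟩, inferInstance⟩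
    have h1 : z U₀ = (p N : P ⧸ U₀.toSubgroup) := hzcompat U₀ N le_rfl
    rw [hπ U₀] at h1
    have h2 : ((ι π : E) : E ⧸ N.toSubgroup) = (ι (p N) : E) := (coe_iota_eq_iff ι N.toSubgroup _ _).mpr h1
    rw [QuotientGroup.mk_mul, h2, hp N, mul_inv_cancel_left]

end Tempered

/-! ### Packaged form -/

section Package

variable {P : Type u} [Group P] [TopologicalSpace P] [IsTopologicalGroup P]
  {A : Type v} [Group A] [TopologicalSpace A] [IsTopologicalGroup A]
  {E : Type w} [Group E]

/-- **Packaged form for the producer** (`exists_arithTemperedGroup`, GAP G-w4d053-1): from the bare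
extension and the basis `𝓜` one obtains a topology on `E` making it a TEMPERED topological group in
which the members of `𝓜` are open, `ι` is a closed embedding and `aug` a continuous open surjection.
[cite: MochizukiSemiAnbd2006, Prop 5.2 (iv), p. 64] -/
theorem exists_isTempered_topology_of_subgroupBasis
    (ι : P →* E) (aug : E →* A) (𝓜 : Set (Subgroup E))
    (hP : IsTempered P) (hA : IsTempered A)
    (hι : Function.Injective ι) (hex : ι.range = aug.ker) (hsurj : Function.Surjective aug)
    (hne : 𝓜.Nonempty) (hdir : ∀ M₁ ∈ 𝓜, ∀ M₂ ∈ 𝓜, ∃ M₃ ∈ 𝓜, M₃ ≤ M₁ ⊓ M₂)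
    (hT1 : ∀ M ∈ 𝓜, IsOpen ((M.comap ι : Subgroup P) : Set P))
    (hT1' : ∀ M ∈ 𝓜, IsOpen ((M.map aug : Subgroup A) : Set A))
    (hT3 : ∀ U ∈ 𝓝 (1 : P), ∃ M ∈ 𝓜, ((M.comap ι : Subgroup P) : Set P) ⊆ U)
    (hT5 : ∀ V ∈ 𝓝 (1 : A), ∃ M ∈ 𝓜, ((M.map aug : Subgroup A) : Set A) ⊆ V)
    (hT6 : ∀ M ∈ 𝓜, ∃ N ∈ 𝓜, N ≤ M ∧ N.Normal) :
    ∃ τ : TopologicalSpace E, @IsTopologicalGroup E τ _ ∧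
      (@nhds E τ 1).HasBasis (fun M : Subgroup E => M ∈ 𝓜) (fun M => (M : Set E)) ∧
      (∀ M ∈ 𝓜, @IsOpen E τ M) ∧ @IsTempered E _ τ ∧
      @IsEmbedding P E _ τ ι ∧ @IsClosed E τ (Set.range ι) ∧
      @Continuous E A τ _ aug ∧ @IsOpenMap E A τ _ aug := by
  obtain ⟨τ, hτ, hb⟩ := exists_groupTopology_of_subgroupBasis_of_normal 𝓜 hne hdir hT6
  letI := τ
  exact ⟨τ, hτ, hb, fun M hM => isOpen_of_mem hb hM,
    isTempered_of_subgroupBasis ι aug hb hP hA hex hsurj hT1 hT1' hT3 hT5 hT6,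
    isEmbedding_iota ι hb hι hT1 hT3,
    isClosed_range_iota ι aug hex (continuous_aug aug hb hT5)
      (isClosed_singleton_one_of_isTempered hA),
    continuous_aug aug hb hT5, isOpenMap_aug aug hb hT1'⟩

end Package

/-! ### Packaged form over a family of KERNELS (the arithmetic tree levels) -/

section Kernels

variable {P : Type u} [Group P] [TopologicalSpace P] [IsTopologicalGroup P]
  {A : Type v} [Group A] [TopologicalSpace A] [IsTopologicalGroup A]
  {E : Type w} [Group E]

/-- **The tempered topology generated by a family of kernels and the augmentation** (the shape the
tower half T54-B-tower hands over: `𝓚 = {ker (arithTreeAct n)}`, the kernels of the actions of `E` on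
the arithmetic tree levels).  The basis of neighbourhoods of `1` is `{K ⊓ aug⁻¹U | K ∈ 𝓚, U ⊴ Π_A open}`
— intersecting with the `aug⁻¹U` is what makes `aug` continuous and `E` separated even when the outer
action `Π_A → Out(Π)` has a kernel (print: the arithmetic tempered coverings `(𝒢, A′, ρ|_{A′})` with
trivial geometric part are among the objects of `B^temp(𝔊)`, Prop 5.2 (iii)).  Hypotheses on `𝓚`:
nonempty, downward directed, normal members, traces `ι⁻¹K` open and cofinal in `𝓝 1` of `Π`
(= cofinality of the universal graph-coverings of the finite Galois levels among tempered coverings,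
Def 3.5), images `aug K` open in `Π_A` (= Def 5.1 (i)(c)(d) continuity, Prop 5.2 (i)(ii)).  Conclusion:
a tempered group topology on `E` with every `K ∈ 𝓚` and every `aug⁻¹U` open, `ι` a closed embedding,
`aug` continuous and open. [cite: MochizukiSemiAnbd2006, Prop 5.2 (iv), p. 64] -/
theorem exists_isTempered_topology_of_kernelFamily
    (ι : P →* E) (aug : E →* A) (𝓚 : Set (Subgroup E))
    (hP : IsTempered P) (hA : IsTempered A)
    (hι : Function.Injective ι) (hex : ι.range = aug.ker) (hsurj : Function.Surjective aug)
    (hne : 𝓚.Nonempty) (hdir : ∀ K₁ ∈ 𝓚, ∀ K₂ ∈ 𝓚, ∃ K₃ ∈ 𝓚, K₃ ≤ K₁ ⊓ K₂)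
    (hnormal : ∀ K ∈ 𝓚, K.Normal)
    (hK1 : ∀ K ∈ 𝓚, IsOpen ((K.comap ι : Subgroup P) : Set P))
    (hK1' : ∀ K ∈ 𝓚, IsOpen ((K.map aug : Subgroup A) : Set A))
    (hK3 : ∀ U ∈ 𝓝 (1 : P), ∃ K ∈ 𝓚, ((K.comap ι : Subgroup P) : Set P) ⊆ U) :
    ∃ τ : TopologicalSpace E, @IsTopologicalGroup E τ _ ∧
      (@nhds E τ 1).HasBasis
        (fun KU : Subgroup E × OpenNormalSubgroup A => KU.1 ∈ 𝓚)
        (fun KU => ((KU.1 ⊓ KU.2.toSubgroup.comap aug : Subgroup E) : Set E)) ∧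
      (∀ K ∈ 𝓚, @IsOpen E τ K) ∧ @IsTempered E _ τ ∧
      @IsEmbedding P E _ τ ι ∧ @IsClosed E τ (Set.range ι) ∧
      @Continuous E A τ _ aug ∧ @IsOpenMap E A τ _ aug := by
  classical
  -- the open normal subgroup `⊤` of `Π_A`
  let U₀ : OpenNormalSubgroup A :=
    { toOpenSubgroup := ⊤, isNormal' := by
        change (⊤ : Subgroup A).Normal
        infer_instance }
  -- the basis `𝓜 = {K ⊓ aug⁻¹ U}`
  let 𝓜 : Set (Subgroup E) :=
    {M | ∃ K ∈ 𝓚, ∃ U : OpenNormalSubgroup A, M = K ⊓ U.toSubgroup.comap aug}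
  have hmem : ∀ K ∈ 𝓚, ∀ U : OpenNormalSubgroup A, K ⊓ U.toSubgroup.comap aug ∈ 𝓜 :=
    fun K hK U => ⟨K, hK, U, rfl⟩
  -- traces and images of the basic subgroups
  have htrace : ∀ K : Subgroup E, ∀ U : OpenNormalSubgroup A,
      (K ⊓ U.toSubgroup.comap aug).comap ι = K.comap ι := by
    intro K U
    ext p
    simp only [Subgroup.mem_comap, Subgroup.mem_inf]
    constructor
    · exact fun h => h.1
    · intro h
      refine ⟨h, ?_⟩
      change aug (ι p) ∈ U.toSubgroup
      rw [aug_iota ι aug hex p]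
      exact one_mem _
  have himage : ∀ K : Subgroup E, ∀ U : OpenNormalSubgroup A,
      (K ⊓ U.toSubgroup.comap aug).map aug = K.map aug ⊓ U.toSubgroup := by
    intro K U
    ext a
    simp only [Subgroup.mem_map, Subgroup.mem_inf, Subgroup.mem_comap]
    constructor
    · rintro ⟨k, ⟨hk, hkU⟩, rfl⟩
      exact ⟨⟨k, hk, rfl⟩, hkU⟩
    · rintro ⟨⟨k, hk, rfl⟩, hkU⟩
      exact ⟨k, ⟨hk, hkU⟩, rfl⟩
  obtain ⟨K₀, hK₀⟩ := hne
  have hne' : 𝓜.Nonempty := ⟨_, hmem K₀ hK₀ U₀⟩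
  have hdir' : ∀ M₁ ∈ 𝓜, ∀ M₂ ∈ 𝓜, ∃ M₃ ∈ 𝓜, M₃ ≤ M₁ ⊓ M₂ := by
    rintro _ ⟨K₁, hK₁, U₁, rfl⟩ _ ⟨K₂, hK₂, U₂, rfl⟩
    obtain ⟨K₃, hK₃, hle⟩ := hdir K₁ hK₁ K₂ hK₂
    refine ⟨_, hmem K₃ hK₃ (U₁ ⊓ U₂), ?_⟩
    rintro x ⟨hx, hxU⟩
    have hxU' : aug x ∈ (U₁ ⊓ U₂).toSubgroup := hxU
    exact ⟨⟨(hle hx).1, hxU'.1⟩, ⟨(hle hx).2, hxU'.2⟩⟩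
  have hT1 : ∀ M ∈ 𝓜, IsOpen ((M.comap ι : Subgroup P) : Set P) := by
    rintro _ ⟨K, hK, U, rfl⟩
    rw [htrace]
    exact hK1 K hK
  have hT1' : ∀ M ∈ 𝓜, IsOpen ((M.map aug : Subgroup A) : Set A) := by
    rintro _ ⟨K, hK, U, rfl⟩
    rw [himage, Subgroup.coe_inf]
    exact (hK1' K hK).inter U.toOpenSubgroup.isOpen
  have hT3 : ∀ U ∈ 𝓝 (1 : P), ∃ M ∈ 𝓜, ((M.comap ι : Subgroup P) : Set P) ⊆ U := by
    intro U hU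
    obtain ⟨K, hK, hKU⟩ := hK3 U hU
    refine ⟨_, hmem K hK U₀, ?_⟩
    rw [htrace]
    exact hKU
  have hT5 : ∀ V ∈ 𝓝 (1 : A), ∃ M ∈ 𝓜, ((M.map aug : Subgroup A) : Set A) ⊆ V := by
    intro V hV
    obtain ⟨U, -, hUV⟩ := hA.basis V hV
    refine ⟨_, hmem K₀ hK₀ U, ?_⟩
    rw [himage]
    exact fun a ha => hUV ha.2
  have hT6 : ∀ M ∈ 𝓜, ∃ N ∈ 𝓜, N ≤ M ∧ N.Normal := by
    rintro _ ⟨K, hK, U, rfl⟩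
    haveI := hnormal K hK
    exact ⟨_, hmem K hK U, le_rfl, inferInstance⟩
  obtain ⟨τ, hτ, hb, hopen, htemp, hemb, hcl, hcont, hopenmap⟩ :=
    exists_isTempered_topology_of_subgroupBasis ι aug 𝓜 hP hA hι hex hsurj hne' hdir' hT1 hT1' hT3
      hT5 hT6
  letI := τ
  refine ⟨τ, hτ, ?_, fun K hK => ?_, htemp, hemb, hcl, hcont, hopenmap⟩
  · refine ⟨fun S => ?_⟩
    rw [hb.mem_iff]
    constructor
    · rintro ⟨_, ⟨K, hK, U, rfl⟩, hS⟩
      exact ⟨(K, U), hK, hS⟩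
    · rintro ⟨⟨K, U⟩, hK, hS⟩
      exact ⟨_, hmem K hK U, hS⟩
  · exact isOpen_of_le hb (hmem K hK U₀) inf_le_left

/-- **Sequence form** (the tower half's shape: an antitone sequence of kernels `K n = ker (arithTreeAct n)`
indexed by the levels of the arithmetic Galois tower).
[cite: MochizukiSemiAnbd2006, Prop 5.2 (iv), p. 64] -/
theorem exists_isTempered_topology_of_kernelSeq
    (ι : P →* E) (aug : E →* A) (K : ℕ → Subgroup E)
    (hP : IsTempered P) (hA : IsTempered A)
    (hι : Function.Injective ι) (hex : ι.range = aug.ker) (hsurj : Function.Surjective aug)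
    (hanti : Antitone K) (hnormal : ∀ n, (K n).Normal)
    (hK1 : ∀ n, IsOpen (((K n).comap ι : Subgroup P) : Set P))
    (hK1' : ∀ n, IsOpen (((K n).map aug : Subgroup A) : Set A))
    (hK3 : ∀ U ∈ 𝓝 (1 : P), ∃ n, (((K n).comap ι : Subgroup P) : Set P) ⊆ U) :
    ∃ τ : TopologicalSpace E, @IsTopologicalGroup E τ _ ∧
      (@nhds E τ 1).HasBasis (fun _ : ℕ × OpenNormalSubgroup A => True)
        (fun nU => ((K nU.1 ⊓ nU.2.toSubgroup.comap aug : Subgroup E) : Set E)) ∧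
      (∀ n, @IsOpen E τ (K n)) ∧ @IsTempered E _ τ ∧
      @IsEmbedding P E _ τ ι ∧ @IsClosed E τ (Set.range ι) ∧
      @Continuous E A τ _ aug ∧ @IsOpenMap E A τ _ aug := by
  obtain ⟨τ, hτ, hb, hopen, htemp, hemb, hcl, hcont, hopenmap⟩ :=
    exists_isTempered_topology_of_kernelFamily ι aug (Set.range K) hP hA hι hex hsurj
      (Set.range_nonempty K)
      (by
        rintro _ ⟨m, rfl⟩ _ ⟨n, rfl⟩
        exact ⟨K (max m n), ⟨max m n, rfl⟩,
          le_inf (hanti (le_max_left m n)) (hanti (le_max_right m n))⟩)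
      (by rintro _ ⟨n, rfl⟩; exact hnormal n) (by rintro _ ⟨n, rfl⟩; exact hK1 n)
      (by rintro _ ⟨n, rfl⟩; exact hK1' n)
      (fun U hU => by obtain ⟨n, hn⟩ := hK3 U hU; exact ⟨K n, ⟨n, rfl⟩, hn⟩)
  refine ⟨τ, hτ, ?_, fun n => hopen (K n) ⟨n, rfl⟩, htemp, hemb, hcl, hcont, hopenmap⟩
  refine ⟨fun S => ?_⟩
  rw [hb.mem_iff]
  constructor
  · rintro ⟨⟨_, U⟩, ⟨n, rfl⟩, hS⟩
    exact ⟨(n, U), trivial, hS⟩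
  · rintro ⟨⟨n, U⟩, -, hS⟩
    exact ⟨(K n, U), ⟨n, rfl⟩, hS⟩

end Kernels

end TemperedExtension

end Literature.AnabelianGeometry.SemiGraphs
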